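import Summits.Ventures.PercRepro0.Sharpness
import Summits.Ventures.PercRepro0.Bridge

/-!
# SHARP-S2 and SHARP-S3 as landed statements: `p_c = p̃_c ≥ 1/(2d)` and the mean-field lower bound
(seat p4, block P5 in Lean, supplement)

SHARP-p4-v2 §2, §4 and §5 on `Defs` — the statements of the summary §5 that `Sharpness.lean` proves only inside
the proof of `P5_Sharpness_holds` (rev-1 remark R2, 2026-08-26T01:55:40Z), now as named theorems:

* `pcTilde d` = `p̃_c = sup{p ∈ [0,1] : ∃ finite S ∋ 0, φ_p(S) < 1}` (SHARP Definition 2.2; `phiSet d` is the set);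
* `one_le_phi_one`: `φ_1(S) ≥ 1` for every finite `S ∋ 0` (the component of `0` inside `S` is finite, so its vertex
  with the largest first coordinate has its `+e_0` neighbour outside `S`), so `1 ∉ phiSet d`;
* `pcTilde_le_pc` (Theorem S1(iii) + L0: every `p ∈ phiSet d` has `θ(p) = 0`), `pc_le_pcTilde` (Theorem S2 through
  `Sharpness.exists_phi_lt_one`), hence **SHARP-S3** `pc_eq_pcTilde : p_c(d) = p̃_c` and
  `inv_two_mul_le_pc : 1/(2d) ≤ p_c(d)` (Lemma 2.3(c): `φ_p({0}) ≤ 2dp`);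
* `one_le_phi_of_pc_lt` (Lemma 2.3(b) at `p̃_c = p_c`) and **SHARP-S2** `theta_ge_of_pc_lt`:
  `θ_d(p) ≥ (p − p_c)/(p(1 − p_c))` for `p_c(d) < p ≤ 1` (the integration step `Planar.lower_bound_of_deriv_ge` at
  `a = p_c`, then `n → ∞`).

All for `d ≥ 1`; optional evidence, off every declaration path; nothing here is used by the certificate.
-/

namespace Summit.Ventures.PercRepro0.Sharp

open MeasureTheory ProbabilityTheory unitInterval Set Filter
open Summit.Ventures.PercRepro0.Defs
open scoped ENNReal Classical Topology

variable {d : ℕ}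

/-! ### `p̃_c` -/

/-- The set `{p ∈ [0,1] : ∃ finite S ∋ 0, φ_p(S) < 1}` whose supremum is `p̃_c`. -/
def phiSet (d : ℕ) : Set ℝ :=
  {p : ℝ | p ∈ Set.Icc (0 : ℝ) 1 ∧ ∃ S : Finset (Vertex d), (0 : Vertex d) ∈ S ∧ phi S (clamp p) < 1}

/-- `p̃_c = sup{p ∈ [0,1] : ∃ finite S ∋ 0, φ_p(S) < 1}` (SHARP Definition 2.2). -/
noncomputable def pcTilde (d : ℕ) : ℝ := sSup (phiSet d)

/-- `clamp` is the identity on the unit interval. -/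
theorem clamp_coe (q : I) : clamp (q : ℝ) = q := Subtype.ext (Russo.coe_clamp_of_mem q.2.1 q.2.2)

/-- `0 ∈ phiSet d` (with `S = {0}`, `φ_0 = 0`). -/
theorem zero_mem_phiSet : (0 : ℝ) ∈ phiSet d :=
  ⟨⟨le_rfl, zero_le_one⟩, {0}, Finset.mem_singleton_self _, by rw [clamp_zero, phi_zero]; exact zero_lt_one⟩

/-- `phiSet d` is bounded above by `1`. -/
theorem phiSet_bddAbove : BddAbove (phiSet d) := ⟨1, fun _ hp => hp.1.2⟩

/-- `0 ≤ p̃_c`. -/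
theorem pcTilde_nonneg : 0 ≤ pcTilde d := le_csSup phiSet_bddAbove zero_mem_phiSet

/-- `p̃_c ≤ 1`. -/
theorem pcTilde_le_one : pcTilde d ≤ 1 := csSup_le ⟨0, zero_mem_phiSet⟩ fun _ hp => hp.1.2

/-! ### `φ_1(S) ≥ 1`: the point `1` is not in `phiSet` -/

/-- `P_1(A) = 1` for an event containing the full configuration (`setBernoulli_one`). -/
theorem P_one_toReal_eq_one {A : Set (Config d)} (h : bonds d ∈ A) : (P d 1 A).toReal = 1 := by
  unfold P
  rw [setBernoulli_one, Measure.dirac_apply_of_mem h]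
  simp

/-- `φ_1(S) ≥ 1` for every finite `S ∋ 0` (`d ≥ 1`): the component `C` of `0` inside `S` (all bonds open) is
finite; its vertex `x` with the largest first coordinate has `y = x + e_0 ∉ S`, so `|{y ∉ S : y ∼ x}| ≥ 1` and
`P_1(0 ↔_S x) = 1`. -/
theorem one_le_phi_one (hd : 1 ≤ d) {S : Finset (Vertex d)} (hS0 : (0 : Vertex d) ∈ S) : 1 ≤ phi S 1 := by
  let i : Fin d := ⟨0, hd⟩
  set C : Finset (Vertex d) := S.filter fun x => ConnIn (↑S) (bonds d) 0 x with hC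
  have h0C : (0 : Vertex d) ∈ C := Finset.mem_filter.2 ⟨hS0, connIn_refl _ _ _⟩
  obtain ⟨x, hxC, hxmax⟩ := Finset.exists_max_image C (fun x => x i) ⟨0, h0C⟩
  have hxS : x ∈ S := (Finset.mem_filter.1 hxC).1
  have hx0 : ConnIn (↑S) (bonds d) 0 x := (Finset.mem_filter.1 hxC).2
  set y : Vertex d := L2.step x i true with hy
  have hadj : (lattice d).Adj x y := L2.lattice_adj_step x i true
  have hb : s(x, y) ∈ bonds d := (lattice d).mem_edgeSet.2 hadj
  have hyi : y i = x i + 1 := by simp [hy, L2.step]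
  have hyS : y ∉ S := by
    intro hyS
    have hyC : y ∈ C :=
      Finset.mem_filter.2 ⟨hyS, connIn_trans hx0 (connIn_of_adj hb hb hxS hyS)⟩
    have := hxmax y hyC
    rw [hyi] at this
    omega
  have hcard : 1 ≤ (outNbrs (↑S) x).card := Finset.card_pos.2 ⟨y, mem_outNbrs.2 ⟨hadj, hyS⟩⟩
  have hPx : (P d 1 {ω : Config d | ConnIn (↑S) ω 0 x}).toReal = 1 := P_one_toReal_eq_one hx0
  have hterm : (1 : ℝ) ≤ ((outNbrs (↑S) x).card : ℝ) * (P d 1 {ω : Config d | ConnIn (↑S) ω 0 x}).toReal := by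
    rw [hPx, mul_one]
    exact_mod_cast hcard
  have hsum : ((outNbrs (↑S) x).card : ℝ) * (P d 1 {ω : Config d | ConnIn (↑S) ω 0 x}).toReal ≤
      ∑ z ∈ S, ((outNbrs (↑S) z).card : ℝ) * (P d 1 {ω : Config d | ConnIn (↑S) ω 0 z}).toReal :=
    Finset.single_le_sum (f := fun z => ((outNbrs (↑S) z).card : ℝ) *
      (P d 1 {ω : Config d | ConnIn (↑S) ω 0 z}).toReal)
      (fun z _ => mul_nonneg (Nat.cast_nonneg _) ENNReal.toReal_nonneg) hxS
  unfold phi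
  simp only [Set.Icc.coe_one, one_mul]
  linarith

/-! ### SHARP-S3: `p_c = p̃_c ≥ 1/(2d)` -/

/-- `e^{-cn} → 0` along `n : ℕ`, for `c > 0`. -/
theorem tendsto_exp_neg_mul_natCast {c : ℝ} (hc : 0 < c) :
    Tendsto (fun n : ℕ => Real.exp (-(c * n))) atTop (𝓝 0) :=
  Real.tendsto_exp_neg_atTop_nhds_zero.comp ((tendsto_natCast_atTop_atTop (R := ℝ)).const_mul_atTop hc)

/-- Theorem S1(iii): `θ_d(p) = 0` whenever `φ_p(S) < 1` for some finite `S ∋ 0` and `p < 1`. -/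
theorem thetaI_eq_zero_of_phi_lt_one (p : I) (hp1 : (p : ℝ) < 1) {S : Finset (Vertex d)}
    (hS0 : (0 : Vertex d) ∈ S) (hphi : phi S p < 1) : thetaI d p = 0 := by
  obtain ⟨L, hL, hSL⟩ := exists_box_bound S
  obtain ⟨c, hc, hdec⟩ := exp_decay_of_phi_lt_one p hp1 S hS0 hL hSL hphi
  refine le_antisymm ?_ (thetaI_nonneg d p)
  refine ge_of_tendsto (tendsto_exp_neg_mul_natCast hc) ?_
  rw [Filter.eventually_atTop]
  exact ⟨1, fun n hn => (thetaI_le_P_toBoundary p n).trans (hdec n hn)⟩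

/-- `p̃_c ≤ p_c(d)` (`d ≥ 1`): every `p ∈ phiSet d` has `θ_d(p) = 0` (`p < 1` by `one_le_phi_one`), and `p_c` is the
supremum of `zeroSet d` (L0). -/
theorem pcTilde_le_pc (hd : 1 ≤ d) : pcTilde d ≤ pc d := by
  rw [pc_eq_sSup_zeroSet' hd]
  refine csSup_le ⟨0, zero_mem_phiSet⟩ fun p hp => le_csSup zeroSet_bddAbove ?_
  obtain ⟨⟨hp0, hp1⟩, S, hS0, hphi⟩ := hp
  refine ⟨⟨hp0, hp1⟩, ?_⟩
  have hp1' : p < 1 := by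
    rcases eq_or_lt_of_le hp1 with h1 | h1
    · exfalso
      rw [h1, clamp_one] at hphi
      exact absurd hphi (not_lt.2 (one_le_phi_one hd hS0))
    · exact h1
  exact thetaI_eq_zero_of_phi_lt_one (clamp p) (by rw [Russo.coe_clamp_of_mem hp0 hp1]; exact hp1') hS0 hphi

/-- `p_c(d) ≤ p̃_c` (`d ≥ 1`; Theorem S2 through `exists_phi_lt_one`). -/
theorem pc_le_pcTilde (hd : 1 ≤ d) : pc d ≤ pcTilde d := by
  by_contra hcon
  have hlt : pcTilde d < pc d := not_le.mp hcon
  have hpt0 : 0 ≤ pcTilde d := pcTilde_nonneg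
  have hpc1 : pc d ≤ 1 := pc_le_one hd
  set p : ℝ := (pcTilde d + pc d) / 2 with hp
  have hp0 : 0 ≤ p := by rw [hp]; linarith
  have hp1 : p ≤ 1 := by rw [hp]; linarith
  have hppc : p < pc d := by rw [hp]; linarith
  have hpt : pcTilde d < p := by rw [hp]; linarith
  have hpI : ((clamp p : I) : ℝ) = p := Russo.coe_clamp_of_mem hp0 hp1
  obtain ⟨A, h0A, hphi⟩ := exists_phi_lt_one hd (p := clamp p) (by rw [hpI]; exact hppc)
  have hmem : p ∈ phiSet d := ⟨⟨hp0, hp1⟩, A, h0A, hphi⟩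
  have : p ≤ pcTilde d := le_csSup phiSet_bddAbove hmem
  linarith

/-- **SHARP-S3, first half**: `p_c(d) = p̃_c` (`d ≥ 1`). -/
theorem pc_eq_pcTilde (hd : 1 ≤ d) : pc d = pcTilde d :=
  le_antisymm (pc_le_pcTilde hd) (pcTilde_le_pc hd)

/-- `|{y ∉ S : y ∼ x}| ≤ 2d`. -/
theorem card_outNbrs_le (S : Set (Vertex d)) (x : Vertex d) : (outNbrs S x).card ≤ 2 * d := by
  calc (outNbrs S x).card ≤ (nbrs x).card := Finset.card_filter_le _ _
    _ ≤ (Finset.univ : Finset (Fin d × Bool)).card := Finset.card_image_le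
    _ = 2 * d := by
        rw [Finset.card_univ, Fintype.card_prod, Fintype.card_fin, Fintype.card_bool, mul_comm]

/-- Lemma 2.3(c): `φ_p({0}) ≤ 2dp`. -/
theorem phi_singleton_le (p : I) : phi ({0} : Finset (Vertex d)) p ≤ 2 * d * p := by
  unfold phi
  rw [Finset.sum_singleton]
  have hc : ((outNbrs (({0} : Finset (Vertex d)) : Set (Vertex d)) 0).card : ℝ) ≤ 2 * d := by
    exact_mod_cast card_outNbrs_le _ _
  have hP1 : (P d p {ω : Config d | ConnIn (({0} : Finset (Vertex d)) : Set (Vertex d)) ω 0 0}).toReal ≤ 1 := by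
    have := ENNReal.toReal_mono ENNReal.one_ne_top
      (prob_le_one (μ := P d p) (s := {ω : Config d | ConnIn (({0} : Finset (Vertex d)) : Set (Vertex d)) ω 0 0}))
    rwa [ENNReal.toReal_one] at this
  have hP0 : 0 ≤ (P d p {ω : Config d | ConnIn (({0} : Finset (Vertex d)) : Set (Vertex d)) ω 0 0}).toReal :=
    ENNReal.toReal_nonneg
  have hd0 : (0 : ℝ) ≤ 2 * d := by positivity
  calc (p : ℝ) * (((outNbrs (({0} : Finset (Vertex d)) : Set (Vertex d)) 0).card : ℝ) *
        (P d p {ω : Config d | ConnIn (({0} : Finset (Vertex d)) : Set (Vertex d)) ω 0 0}).toReal)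
      ≤ (p : ℝ) * (2 * d * 1) := mul_le_mul_of_nonneg_left (mul_le_mul hc hP1 hP0 hd0) p.2.1
    _ = 2 * d * p := by ring

/-- **SHARP-S3, second half**: `1/(2d) ≤ p_c(d)` (`d ≥ 1`). -/
theorem inv_two_mul_le_pc (hd : 1 ≤ d) : 1 / (2 * (d : ℝ)) ≤ pc d := by
  rw [pc_eq_pcTilde hd]
  have hd' : (0 : ℝ) < 2 * d := by positivity
  have hd1 : (1 : ℝ) ≤ d := by exact_mod_cast hd
  have h2d : 1 / (2 * (d : ℝ)) ≤ 1 := by rw [div_le_one hd']; linarith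
  have h2d0 : 0 < 1 / (2 * (d : ℝ)) := by positivity
  by_contra hcon
  have hlt : pcTilde d < 1 / (2 * d) := not_le.mp hcon
  have hpt0 : 0 ≤ pcTilde d := pcTilde_nonneg
  set q : ℝ := (pcTilde d + 1 / (2 * d)) / 2 with hq
  have hq0 : 0 ≤ q := by rw [hq]; linarith
  have hq1 : q < 1 / (2 * d) := by rw [hq]; linarith
  have hq2 : pcTilde d < q := by rw [hq]; linarith
  have hq3 : q ≤ 1 := by linarith
  have hqI : ((clamp q : I) : ℝ) = q := Russo.coe_clamp_of_mem hq0 hq3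
  have hphi : phi ({0} : Finset (Vertex d)) (clamp q) < 1 := by
    calc phi ({0} : Finset (Vertex d)) (clamp q) ≤ 2 * d * ((clamp q : I) : ℝ) := phi_singleton_le _
      _ = 2 * d * q := by rw [hqI]
      _ < 2 * d * (1 / (2 * d)) := by gcongr
      _ = 1 := by field_simp
  have hmem : q ∈ phiSet d := ⟨⟨hq0, hq3⟩, {0}, Finset.mem_singleton_self _, hphi⟩
  have : q ≤ pcTilde d := le_csSup phiSet_bddAbove hmem
  linarith

/-! ### SHARP-S2: the mean-field lower bound -/

/-- Lemma 2.3(b) at `p̃_c = p_c`: above `p_c(d)`, `φ_q(A) ≥ 1` for every finite `A ∋ 0` (`d ≥ 1`). -/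
theorem one_le_phi_of_pc_lt (hd : 1 ≤ d) {q : I} (hq : pc d < q) {A : Finset (Vertex d)}
    (h0A : (0 : Vertex d) ∈ A) : 1 ≤ phi A q := by
  by_contra hcon
  have hlt : phi A q < 1 := not_le.mp hcon
  have hmem : (q : ℝ) ∈ phiSet d := ⟨⟨q.2.1, q.2.2⟩, A, h0A, by rwa [clamp_coe]⟩
  have : (q : ℝ) ≤ pcTilde d := le_csSup phiSet_bddAbove hmem
  rw [pc_eq_pcTilde hd] at hq
  linarith

/-- **SHARP-S2** (mean-field lower bound, Theorem S2): `θ_d(p) ≥ (p − p_c)/(p(1 − p_c))` for `p_c(d) < p ≤ 1`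
(`d ≥ 1`). -/
theorem theta_ge_of_pc_lt (hd : 1 ≤ d) {p : ℝ} (hp : pc d < p) (hp1 : p ≤ 1) :
    (p - pc d) / (p * (1 - pc d)) ≤ theta d p := by
  have h2d0 : 0 < 1 / (2 * (d : ℝ)) := by positivity
  have hpc0 : 0 < pc d := lt_of_lt_of_le h2d0 (inv_two_mul_le_pc hd)
  have hpc1 : pc d < 1 := lt_of_lt_of_le hp hp1
  rcases eq_or_lt_of_le hp1 with h1 | h1
  · subst h1
    rw [theta_one hd, one_mul, div_self (ne_of_gt (by linarith))]
  · have hφ : ∀ q : ℝ, pc d < q → q < 1 → ∀ A : Finset (Vertex d), (0 : Vertex d) ∈ A →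
        1 ≤ phi A (clamp q) := by
      intro q hq hq1 A h0A
      refine one_le_phi_of_pc_lt hd ?_ h0A
      rw [Russo.coe_clamp_of_mem (by linarith) hq1.le]
      exact hq
    have hbound : ∀ n : ℕ, 1 ≤ n → (p - pc d) / (p * (1 - pc d)) ≤ thetaBox d n p := by
      intro n hn
      refine Planar.lower_bound_of_deriv_ge (thetaBox d n) (pc d) hpc0 hpc1 ?_ ?_ ?_ ?_ ⟨hp, h1⟩
      · intro q hq
        exact (hasDerivAt_thetaBox n hq.1 hq.2).differentiableAt
      · intro q _
        exact ENNReal.toReal_nonneg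
      · intro q hq
        exact thetaBox_lt_one n hn hq.1.le hq.2
      · intro q hq
        exact deriv_thetaBox_ge n (lt_trans hpc0 hq.1) hq.2 (hφ q hq.1 hq.2)
    unfold theta
    refine ge_of_tendsto (tendsto_P_toBoundary (d := d) (clamp p)) ?_
    rw [Filter.eventually_atTop]
    exact ⟨1, fun n hn => hbound n hn⟩

end Summit.Ventures.PercRepro0.Sharp
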